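import Literature.IUT.HodgeArakelov.ModelDef11Output
import Literature.IUT.HodgeArakelov.ModelCyclotomesZHat
import Literature.IUT.HodgeArakelov.ModelReconstructionInvariance
import Literature.AnabelianGeometry.EtaleTheta.Discharge.Sec2HcommOfSetting
import Literature.AnabelianGeometry.EtaleTheta.Discharge.Sec2DtpYThetaAbelian
import Literature.AnabelianGeometry.EtaleTheta.Discharge.Sec2ModelCor219Origin

/-!
# Bridge B8, part 8: at the Tate curve THE [IUTchII] Def. 1.1 (ii) rigidity isomorphism is independent of the
# mono-theta identification, and natural under mono-theta isomorphisms (proof-only)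

abc-iut cell, layer L6, seat abc-iut-L6-d6 (gen 3); proof-only companion of B8 part 6 (`ModelDef11Output`,
p411490) and part 7 (`ModelReconstructionInvariance`, p416541) AT THE [EtTh] §1 MODEL `X̲̲_K` (abc-iut-L2-t8's
`DoubleUnderline.rigidData`, the [IUTchII] §1 setting `ThetaSetting.ofDoubleUnderline` of part 3).

* `nonempty_modelFrame_ofDoubleUnderline`: part 5b's `ModelFrame` is INHABITED at the Tate curve with the `hZ`
  hypothesis of part 6 ("`(l·Δ_Θ)/thetaKer ≅ Ẑ`", [EtTh] §1 p. 12; gap G-w4d021-1) DISCHARGED by abc-iut-w5-d218 /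
  abc-iut-L2-d1 / abc-iut-w5-d171's `ModelCyclotomes.nonempty_lDeltaQuot_rigidData_mulEquiv_zHat`
  (`ModelCyclotomesZHat`); the corresponding `hZ`-free EXISTENCE of the Def. 1.1 output is abc-iut-w4-d008's
  `nonempty_def11Output_ofDoubleUnderline_of_origin` (`ModelDef11OutputOfOrigin`, not restated here). Remaining
  inputs: the named fact `Prop15iii` (F-0591, an input of `rigidData` itself), the freeness guard `IsEtThOrigin` and
  the closedness hypothesis `hYcl` (G-w4d021-2) of the §2 rigidity chain.
* `coe_cyclotomicRigidity_trans_eq_of_over_id_ofDoubleUnderline` (+ the two-identification form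
  `coe_cyclotomicRigidity_eq_of_iso_over_id_ofDoubleUnderline`): for the Tate curve THE Def. 1.1 (ii) isomorphism of
  part 5b does not depend on the mono-theta identification within the [EtTh] Cor. 2.18 (iv) fibre — with NO
  FACT-policy input: part 7's `…_of_over_id'` fed with abc-iut-L5-t14's theorem `rigidData_prop214_i` ([EtTh]
  Prop. 2.14 (i) PROVED for the model from `IsEtThOrigin`, abc-iut-L2-t8's `dtpYTheta_comm`, `hYcl`).
* `coe_cyclotomicRigidity_trans_mk_ofDoubleUnderline` / `exists_over_coe_cyclotomicRigidity_trans_mk_ofDoubleUnderline`: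
  the NATURALITY SQUARE `iso_{e ≫ α}[γ g] = iso_e[g]` of part 7 at the Tate curve, modulo [EtTh] Cor. 2.18 (i) BY
  NAME (`Cor218_i`, F-0620, FACT-policy) and temp-slimness of `Π^tp_X` (`IsSlimGroup D.PiTemp`, G-w4d021-3), via
  abc-iut-L2's `cor219_i_splittings_model_of_origin` and `cor218_iii_of_tempSlim`.

HONEST FRAMING: proof-only (no definitions, no new named facts); nothing disputed is asserted; no side is taken on
[IUTchIII] Cor. 3.12; typed ≠ discharged. Sources: [IUTchII] §1 Def. 1.1, Cor. 1.10 [claim: Mochizuki2012, status: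
disputed] (IUTchII §1 Def 1.1, kurims pp.20-21); [cite: MochizukiEtTh2009, Cor 2.19(i) p.64];
[cite: MochizukiEtTh2009, Prop 2.14(i) p.49].
-/

noncomputable section

namespace Literature.IUT.HodgeArakelov

open Literature.AnabelianGeometry.EtaleTheta Literature.AnabelianGeometry.SemiGraphs
open Literature.AlgebraicGeometry.Frobenioids (IsSlimGroup)
open scoped Literature.AnabelianGeometry.EtaleTheta

namespace ThetaSetting

section Tate

variable {p : ℕ} [Fact p.Prime] {D : Literature.AnabelianGeometry.EtaleTheta.ThetaSetting p}
  {E : D.EtaleThetaData} {l : ℕ} (C : E.DoubleUnderline l) {N : ℕ+} (μ : D.CyclotomeMod l N)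
  (hC : D.Compat) (hS : D.Sec2Hyps)

/-- **Part 5b's `ModelFrame` is inhabited for the Tate curve** (`Π^tp_{X̲̲}` T₁ and `Δ` closed by part 6;
`(l·Δ_Θ)/thetaKer ≅ Ẑ` by `ModelCyclotomes.nonempty_lDeltaQuot_rigidData_mulEquiv_zHat`), under `Prop15iii`,
`IsEtThOrigin`, `hYcl`. [claim: Mochizuki2012, status: disputed] (IUTchII §1 Def 1.1 (i), kurims pp.20-21) -/
theorem nonempty_modelFrame_ofDoubleUnderline
    (h15 : Literature.AnabelianGeometry.EtaleTheta.ThetaSetting.Prop15iii E hC) (L : C.CuspLabels)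
    (hl : l.Prime) (hp2 : p ≠ 2) (hpl : p ≠ l) (hζ : ∃ ζ : D.K, IsPrimitiveRoot ζ (4 * l))
    {η : (C.thetaEnvData μ hC hS).PiYdd → MuN p N} (hη : η ∈ (C.thetaEnvData μ hC hS).thetaCocycles)
    (hO : D.IsEtThOrigin)
    (hYcl : (D.DtpY.map D.toHat.toMonoidHom).topologicalClosure ≤
      D.DtpY.map D.toHat.toMonoidHom ⊔ (⁅⁅D.DeltaHat, D.DeltaHat⁆, D.DeltaHat⁆).topologicalClosure) :
    Nonempty (ModelFrame (ofDoubleUnderline C μ hC hS hl hp2 hpl hζ hη) (C.rigidData μ hC hS h15 L)) :=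
  ⟨modelFrameOfThetaEnvData (C.rigidData μ hC hS h15 L) (SideData.ofDoubleUnderline C μ hC hS hl hp2 hpl hζ hη)
    (t1Space_Huu C) (isClosed_ker_aug_thetaEnvData C μ hC hS)
    (ModelCyclotomes.nonempty_lDeltaQuot_rigidData_mulEquiv_zHat C μ hC hS h15 L hO hYcl hl.ne_zero)⟩

/-- **THE Def. 1.1 (ii) isomorphism of the Tate curve is independent of the mono-theta identification within the
Cor. 2.18 (iv) fibre — NO FACT-policy input**: for any frame, any identification `e : Π_M ≃ Π^tp_{Y̲̲}[μ_N]` and any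
automorphism `α` of the model mono-theta environment `M(η')` over the identity of `Π^tp_{Y̲̲}`, part 5b's rigidity
isomorphisms at `e` and at `e ≫ α` coincide pointwise in `Π_M`; [EtTh] Prop. 2.14 (i) enters as abc-iut-L5-t14's
THEOREM `rigidData_prop214_i` (from `IsEtThOrigin`, abc-iut-L2-t8's `dtpYTheta_comm`, `hYcl`).
[claim: Mochizuki2012, status: disputed] (IUTchII §1 Def 1.1 (ii), kurims p.21) -/
theorem coe_cyclotomicRigidity_trans_eq_of_over_id_ofDoubleUnderline
    (h15 : Literature.AnabelianGeometry.EtaleTheta.ThetaSetting.Prop15iii E hC) (L : C.CuspLabels)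
    (hl : l.Prime) (hp2 : p ≠ 2) (hpl : p ≠ l) (hζ : ∃ ζ : D.K, IsPrimitiveRoot ζ (4 * l))
    {η : (C.thetaEnvData μ hC hS).PiYdd → MuN p N} (hη : η ∈ (C.thetaEnvData μ hC hS).thetaCocycles)
    (hO : D.IsEtThOrigin)
    (hYcl : (D.DtpY.map D.toHat.toMonoidHom).topologicalClosure ≤
      D.DtpY.map D.toHat.toMonoidHom ⊔ (⁅⁅D.DeltaHat, D.DeltaHat⁆, D.DeltaHat⁆).topologicalClosure)
    (F : ModelFrame (ofDoubleUnderline C μ hC hS hl hp2 hpl hζ hη) (C.rigidData μ hC hS h15 L))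
    {M : MonoThetaEnv (ofDoubleUnderline C μ hC hS hl hp2 hpl hζ hη)} (e : M.Pi ≃ₜ* (C.rigidData μ hC hS h15 L).env)
    {η' : (C.rigidData μ hC hS h15 L).PiYdd → (C.rigidData μ hC hS h15 L).mu}
    (hη' : η' ∈ (C.rigidData μ hC hS h15 L).thetaCocycles)
    (α : ((C.rigidData μ hC hS h15 L).modelMono hη').Iso ((C.rigidData μ hC hS h15 L).modelMono hη'))
    (hα : ∀ x, CycEnvelope.proj (C.rigidData μ hC hS h15 L).augY (C.rigidData μ hC hS h15 L).chi (α.e x) =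
      CycEnvelope.proj (C.rigidData μ hC hS h15 L).augY (C.rigidData μ hC hS h15 L).chi x)
    (c : ModPow (ModelCyclotomes.intCyc (C.rigidData μ hC hS h15 L)).carrier
      ((ofDoubleUnderline C μ hC hS hl hp2 hpl hζ hη).N : ℕ)) :
    ((F.cyclotomicRigidity (e.trans α.e)).iso c : M.Pi) = ((F.cyclotomicRigidity e).iso c : M.Pi) :=
  F.coe_cyclotomicRigidity_trans_eq_of_over_id' e
    (C.rigidData_prop214_i μ hC hS h15 L hO (D.dtpYTheta_comm hO) hYcl) hη' α hα c

/-- **Two mono-theta identifications of `M` with the Tate-curve model inducing the same `Π_M ↠ Π^tp_{Y̲̲}` give THE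
SAME Def. 1.1 (ii) isomorphism** (pointwise in `Π_M`) — NO FACT-policy input (Prop. 2.14 (i) for the model is the
theorem `rigidData_prop214_i`). [claim: Mochizuki2012, status: disputed] (IUTchII §1 Def 1.1 (ii), kurims p.21) -/
theorem coe_cyclotomicRigidity_eq_of_iso_over_id_ofDoubleUnderline
    (h15 : Literature.AnabelianGeometry.EtaleTheta.ThetaSetting.Prop15iii E hC) (L : C.CuspLabels)
    (hl : l.Prime) (hp2 : p ≠ 2) (hpl : p ≠ l) (hζ : ∃ ζ : D.K, IsPrimitiveRoot ζ (4 * l))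
    {η : (C.thetaEnvData μ hC hS).PiYdd → MuN p N} (hη : η ∈ (C.thetaEnvData μ hC hS).thetaCocycles)
    (hO : D.IsEtThOrigin)
    (hYcl : (D.DtpY.map D.toHat.toMonoidHom).topologicalClosure ≤
      D.DtpY.map D.toHat.toMonoidHom ⊔ (⁅⁅D.DeltaHat, D.DeltaHat⁆, D.DeltaHat⁆).topologicalClosure)
    (F : ModelFrame (ofDoubleUnderline C μ hC hS hl hp2 hpl hζ hη) (C.rigidData μ hC hS h15 L))
    {M : MonoThetaEnv (ofDoubleUnderline C μ hC hS hl hp2 hpl hζ hη)}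
    {η' : (C.rigidData μ hC hS h15 L).PiYdd → (C.rigidData μ hC hS h15 L).mu}
    {hη' : η' ∈ (C.rigidData μ hC hS h15 L).thetaCocycles}
    (ε ε' : M.toEtale.Iso ((C.rigidData μ hC hS h15 L).modelMono hη'))
    (hproj : ∀ m : M.Pi,
      CycEnvelope.proj (C.rigidData μ hC hS h15 L).augY (C.rigidData μ hC hS h15 L).chi (ε'.e m) =
        CycEnvelope.proj (C.rigidData μ hC hS h15 L).augY (C.rigidData μ hC hS h15 L).chi (ε.e m))
    (c : ModPow (ModelCyclotomes.intCyc (C.rigidData μ hC hS h15 L)).carrier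
      ((ofDoubleUnderline C μ hC hS hl hp2 hpl hζ hη).N : ℕ)) :
    ((F.cyclotomicRigidity ε'.e).iso c : M.Pi) = ((F.cyclotomicRigidity ε.e).iso c : M.Pi) := by
  have hover : ∀ x, CycEnvelope.proj (C.rigidData μ hC hS h15 L).augY (C.rigidData μ hC hS h15 L).chi
      ((MonoThetaBridge.etaleIsoTrans (MonoThetaBridge.etaleIsoSymm ε) ε').e x) =
      CycEnvelope.proj (C.rigidData μ hC hS h15 L).augY (C.rigidData μ hC hS h15 L).chi x := fun x => by
    show CycEnvelope.proj _ _ (ε'.e (ε.e.symm x)) = _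
    rw [hproj, ContinuousMulEquiv.apply_symm_apply]
  rw [ModelFrame.iso_e_eq_trans ε ε']
  exact coe_cyclotomicRigidity_trans_eq_of_over_id_ofDoubleUnderline C μ hC hS h15 L hl hp2 hpl hζ hη hO hYcl F
    ε.e hη' _ hover c

/-- **NATURALITY SQUARE at the Tate curve** ([IUTchII] Cor. 1.10 «functorial algorithm in `Π`», sub-node C110-S10
at level `N`): `iso_{e ≫ α}[γ g] = iso_e[g]` in `Π_M` for every automorphism `α` of the model mono-theta environment
over `γ ∈ Aut(Π^tp_{X̲̲})` — modulo [EtTh] Cor. 2.18 (i) BY NAME (`Cor218_i`, F-0620) and temp-slimness of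
`Π^tp_X` (`IsSlimGroup D.PiTemp`, G-w4d021-3), via abc-iut-L2's `cor219_i_splittings_model_of_origin`.
[claim: Mochizuki2012, status: disputed] (IUTchII §1 Cor 1.10, kurims p.47) -/
theorem coe_cyclotomicRigidity_trans_mk_ofDoubleUnderline
    (h15 : Literature.AnabelianGeometry.EtaleTheta.ThetaSetting.Prop15iii E hC) (L : C.CuspLabels)
    (hl : l.Prime) (hp2 : p ≠ 2) (hpl : p ≠ l) (hζ : ∃ ζ : D.K, IsPrimitiveRoot ζ (4 * l))
    {η : (C.thetaEnvData μ hC hS).PiYdd → MuN p N} (hη : η ∈ (C.thetaEnvData μ hC hS).thetaCocycles)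
    (hslimX : IsSlimGroup D.PiTemp) (h218i : (C.rigidData μ hC hS h15 L).Cor218_i)
    (hO : D.IsEtThOrigin)
    (hYcl : (D.DtpY.map D.toHat.toMonoidHom).topologicalClosure ≤
      D.DtpY.map D.toHat.toMonoidHom ⊔ (⁅⁅D.DeltaHat, D.DeltaHat⁆, D.DeltaHat⁆).topologicalClosure)
    (F : ModelFrame (ofDoubleUnderline C μ hC hS hl hp2 hpl hζ hη) (C.rigidData μ hC hS h15 L))
    {M : MonoThetaEnv (ofDoubleUnderline C μ hC hS hl hp2 hpl hζ hη)} (e : M.Pi ≃ₜ* (C.rigidData μ hC hS h15 L).env)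
    {η' : (C.rigidData μ hC hS h15 L).PiYdd → (C.rigidData μ hC hS h15 L).mu}
    (hη' : η' ∈ (C.rigidData μ hC hS h15 L).thetaCocycles)
    (α : ((C.rigidData μ hC hS h15 L).modelMono hη').Iso ((C.rigidData μ hC hS h15 L).modelMono hη'))
    (γ : (C.rigidData μ hC hS h15 L).PiX ≃ₜ* (C.rigidData μ hC hS h15 L).PiX)
    (hαγ : ∀ x, ((CycEnvelope.proj (C.rigidData μ hC hS h15 L).augY (C.rigidData μ hC hS h15 L).chi (α.e x) :
        (C.rigidData μ hC hS h15 L).PiY) : (C.rigidData μ hC hS h15 L).PiX) =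
      γ ((CycEnvelope.proj (C.rigidData μ hC hS h15 L).augY (C.rigidData μ hC hS h15 L).chi x :
        (C.rigidData μ hC hS h15 L).PiY) : (C.rigidData μ hC hS h15 L).PiX))
    (g : (C.rigidData μ hC hS h15 L).lDeltaTheta) (hγg : γ g ∈ (C.rigidData μ hC hS h15 L).lDeltaTheta) :
    ((F.cyclotomicRigidity (e.trans α.e)).iso
        (((ModelCyclotomes.intCycEquiv (C.rigidData μ hC hS h15 L)).symm
            ((⟨γ g, hγg⟩ : (C.rigidData μ hC hS h15 L).lDeltaTheta) :
              ModelCyclotomes.lDeltaQuot (C.rigidData μ hC hS h15 L)) :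
            (ModelCyclotomes.intCyc (C.rigidData μ hC hS h15 L)).carrier) :
          ModPow (ModelCyclotomes.intCyc (C.rigidData μ hC hS h15 L)).carrier
            ((ofDoubleUnderline C μ hC hS hl hp2 hpl hζ hη).N : ℕ)) : M.Pi) =
      ((F.cyclotomicRigidity e).iso
        (((ModelCyclotomes.intCycEquiv (C.rigidData μ hC hS h15 L)).symm
            (g : ModelCyclotomes.lDeltaQuot (C.rigidData μ hC hS h15 L)) :
            (ModelCyclotomes.intCyc (C.rigidData μ hC hS h15 L)).carrier) :
          ModPow (ModelCyclotomes.intCyc (C.rigidData μ hC hS h15 L)).carrier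
            ((ofDoubleUnderline C μ hC hS hl hp2 hpl hζ hη).N : ℕ)) : M.Pi) :=
  F.coe_cyclotomicRigidity_trans_mk e
    (C.cor219_i_splittings_model_of_origin μ hC hS h15 L hslimX h218i hO (D.dtpYTheta_comm hO) hYcl)
    hη' α γ hαγ g hγg

/-- **Naturality for EVERY automorphism of the Tate-curve model mono-theta environment**: the automorphism `γ`
of `Π^tp_{X̲̲}` is supplied by abc-iut-L2's `exists_gamma_of_cor218` (Cor. 2.18 (iii) from temp-slimness via
`cor218_iii_of_tempSlim` / `tempSlim_Huu`); inputs BY NAME: `Cor218_i` (F-0620), `IsSlimGroup D.PiTemp`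
(G-w4d021-3), `IsEtThOrigin`, `hYcl`. [claim: Mochizuki2012, status: disputed] (IUTchII §1 Cor 1.10, kurims p.47) -/
theorem exists_over_coe_cyclotomicRigidity_trans_mk_ofDoubleUnderline
    (h15 : Literature.AnabelianGeometry.EtaleTheta.ThetaSetting.Prop15iii E hC) (L : C.CuspLabels)
    (hl : l.Prime) (hp2 : p ≠ 2) (hpl : p ≠ l) (hζ : ∃ ζ : D.K, IsPrimitiveRoot ζ (4 * l))
    {η : (C.thetaEnvData μ hC hS).PiYdd → MuN p N} (hη : η ∈ (C.thetaEnvData μ hC hS).thetaCocycles)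
    (hslimX : IsSlimGroup D.PiTemp) (h218i : (C.rigidData μ hC hS h15 L).Cor218_i)
    (hO : D.IsEtThOrigin)
    (hYcl : (D.DtpY.map D.toHat.toMonoidHom).topologicalClosure ≤
      D.DtpY.map D.toHat.toMonoidHom ⊔ (⁅⁅D.DeltaHat, D.DeltaHat⁆, D.DeltaHat⁆).topologicalClosure)
    (F : ModelFrame (ofDoubleUnderline C μ hC hS hl hp2 hpl hζ hη) (C.rigidData μ hC hS h15 L))
    {M : MonoThetaEnv (ofDoubleUnderline C μ hC hS hl hp2 hpl hζ hη)} (e : M.Pi ≃ₜ* (C.rigidData μ hC hS h15 L).env)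
    {η' : (C.rigidData μ hC hS h15 L).PiYdd → (C.rigidData μ hC hS h15 L).mu}
    (hη' : η' ∈ (C.rigidData μ hC hS h15 L).thetaCocycles)
    (α : ((C.rigidData μ hC hS h15 L).modelMono hη').Iso ((C.rigidData μ hC hS h15 L).modelMono hη')) :
    ∃ (γ : (C.rigidData μ hC hS h15 L).PiX ≃ₜ* (C.rigidData μ hC hS h15 L).PiX)
      (hL : ∀ g : (C.rigidData μ hC hS h15 L).lDeltaTheta, γ g ∈ (C.rigidData μ hC hS h15 L).lDeltaTheta),
      (∀ x, ((CycEnvelope.proj (C.rigidData μ hC hS h15 L).augY (C.rigidData μ hC hS h15 L).chi (α.e x) :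
          (C.rigidData μ hC hS h15 L).PiY) : (C.rigidData μ hC hS h15 L).PiX) =
        γ ((CycEnvelope.proj (C.rigidData μ hC hS h15 L).augY (C.rigidData μ hC hS h15 L).chi x :
          (C.rigidData μ hC hS h15 L).PiY) : (C.rigidData μ hC hS h15 L).PiX)) ∧
      ∀ g : (C.rigidData μ hC hS h15 L).lDeltaTheta,
        ((F.cyclotomicRigidity (e.trans α.e)).iso
            (((ModelCyclotomes.intCycEquiv (C.rigidData μ hC hS h15 L)).symm
                ((⟨γ g, hL g⟩ : (C.rigidData μ hC hS h15 L).lDeltaTheta) :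
                  ModelCyclotomes.lDeltaQuot (C.rigidData μ hC hS h15 L)) :
                (ModelCyclotomes.intCyc (C.rigidData μ hC hS h15 L)).carrier) :
              ModPow (ModelCyclotomes.intCyc (C.rigidData μ hC hS h15 L)).carrier
                ((ofDoubleUnderline C μ hC hS hl hp2 hpl hζ hη).N : ℕ)) : M.Pi) =
          ((F.cyclotomicRigidity e).iso
            (((ModelCyclotomes.intCycEquiv (C.rigidData μ hC hS h15 L)).symm
                (g : ModelCyclotomes.lDeltaQuot (C.rigidData μ hC hS h15 L)) :
                (ModelCyclotomes.intCyc (C.rigidData μ hC hS h15 L)).carrier) :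
              ModPow (ModelCyclotomes.intCyc (C.rigidData μ hC hS h15 L)).carrier
                ((ofDoubleUnderline C μ hC hS hl hp2 hpl hζ hη).N : ℕ)) : M.Pi) := by
  obtain ⟨h218P, h218q⟩ := (C.rigidData μ hC hS h15 L).cor218_iii_of_tempSlim (C.tempSlim_Huu hslimX)
  exact F.exists_over_coe_cyclotomicRigidity_trans_mk e h218i h218q h218P
    (C.cor219_i_splittings_model_of_origin μ hC hS h15 L hslimX h218i hO (D.dtpYTheta_comm hO) hYcl) hη' α

end Tate

end ThetaSetting

end Literature.IUT.HodgeArakelov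

end
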